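import Literature.AnabelianGeometry.SemiGraphs.TemperedSpecialFibreCusps
import HarnessLib

/-!
# [SemiAnbd] Cor. 3.11, proof step (C), its anabelian core: the isomorphism `G[α] ⥲ G[β]` induced by
# `γ` MATCHES THE CUSPS — the vertex isomorphisms carry cusp branch groups onto cusp branch groups
# (statements)

Mochizuki, *Semi-graphs of anabelioids*, Publ. RIMS **42** (2006), §3, Corollary 3.11, proof, manuscript
pp. 46–47 = PRIMS pp. 272–273 [cite: MochizukiSemiAnbd2006, Cor 3.11 pp.46-47]: "(ii) The decomposition
groups of cusps in `Δ[□]^Σ` are commensurably terminal [cf. [Mzk3], Lemma 1.3.7]. (iii) Every nontrivial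
image … of the decomposition group of a node in `Δ'[□]^Σ` … is either an open subgroup of an edge-like
subgroup of `Δ[□]^Σ` or an open subgroup of a decomposition group of a cusp in `Δ[□]^Σ` [but not both …].
(iv) Every decomposition group of a cusp in `Δ[□]^Σ` admits an open subgroup that arises as the image …
of an edge-like subgroup of `Δ'[□]^Σ`. … it follows formally from (i), (ii), (iii), (iv) that the natural,
functorial isomorphism of graphs of anabelioids `G[α]_Σ ⥲ G[β]_Σ` induced by `γ` extends uniquely to a
natural, functorial isomorphism of semi-graphs of anabelioids `G^c[α]_Σ ⥲ G^c[β]_Σ`".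

STATEMENTS file (abc-iut cell, layer L3, sub-DAG `plan/L3/SUBDAG-SemiAnbd-Cor311.md`, refinement of
sub-node C; seat abc-iut-w4-d083).  What (i)–(iv) establish, read at the level of the special fibres: the
decomposition groups of the cusps are DETECTED group-theoretically, so the isomorphism `F₀ : G[α] ⥲ G[β]`
of the graphs of anabelioids without compact structure induced by `γ` (Cor. 3.9; an isomorphism at finite
special fibres, `SpecialFibreData.exists_isIso_graphCompatible_of_finite`) MATCHES THE CUSPS: there is a
bijection `σ` between the cusps (open edges) of `G^c[α]` and of `G^c[β]` such that the vertex isomorphism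
`(F₀)_v : Π_v ⥲ Π_{F₀ v}` carries the branch group `Π_{b_x} ⊆ Π_v` of the abutting branch of each cusp
`x` at `v` ONTO a `Π_{F₀ v}`-conjugate of the branch group of the abutting branch of `σ x` (which abuts to
`F₀ v`).  This is the anabelian content of step (C); the rest of (C) — extending `F₀` along the matched
cusps to an isomorphism `G^c[α] ⥲ G^c[β]` chart-compatible with `φ`, and its uniqueness — is
combinatorics and is PROVED in the proof-only sequels (`TemperedSpecialFibreCuspExtension*.lean`;
uniqueness: `cuspExtensionUnique_uniqueness_holds`).

* `SpecialFibreData.CuspMatching Sα Sβ F₀` — the matching datum for a morphism `F₀ : G[α] → G[β]`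
  (at a pair of special-fibre data; no origin hypothesis);
* `CuspBranchesPreserved Ωα Ωβ` — named residual step over the origin hypotheses (assumed by consumers,
  asserted for no instance; FACT-policy, its printed proof being (i)–(iv) with [AbsAnab] Lem. 1.3.7 =
  FACT-LIST F-0003 `AbsoluteAnabelian.CuspidalData.InertiaCommensurablyTerminal` as (ii) and the geometric
  (iv)): for `φ` descended from `γ`, every ISOMORPHISM `F₀ : G[α] ⥲ G[β]` compatible with `φ` matches the
  cusps.

Nothing of the frozen files is altered; nothing here takes a side on [IUTchIII] Cor. 3.12; typed ≠ proved.
-/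

open CategoryTheory Topology

noncomputable section

namespace Literature.AnabelianGeometry.SemiGraphs

open ProfiniteSemiGraph

universe u

section Cor311

variable {Kα : Type u} [Field Kα] {Kβ : Type u} [Field Kβ]

/-- **The cusps are matched by `F₀ : G[α] → G[β]`** (the output of (i)–(iv) of the proof of Cor. 3.11,
pp. 46–47, at the special fibres): a bijection `σ` from the open edges (cusps) of `G^c[α]` to those of
`G^c[β]` such that, for every cusp `x` and its branch `b` abutting to a vertex `v`, some branch `b'` of
`σ x` abuts to `F₀ v` and the vertex homomorphism `(F₀)_v` carries the branch group `Π_b ⊆ Π_v` ONTO a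
`Π_{F₀ v}`-conjugate of the branch group `Π_{b'}` ("decomposition groups of cusps … [correspond]").
[cite: MochizukiSemiAnbd2006, Cor 3.11 pp.46-47] -/
def SpecialFibreData.CuspMatching {Dα : TemperedArithmeticGroup Kα} {Dβ : TemperedArithmeticGroup Kβ}
    (Sα : SpecialFibreData Dα) (Sβ : SpecialFibreData Dβ) (F₀ : Hom Sα.graph Sβ.graph) : Prop :=
  ∃ σ : {e : Sα.Gc.graph.Edge // ¬ Sα.Gc.graph.IsClosedEdge e} ≃
      {e : Sβ.Gc.graph.Edge // ¬ Sβ.Gc.graph.IsClosedEdge e},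
    ∀ (x : {e : Sα.Gc.graph.Edge // ¬ Sα.Gc.graph.IsClosedEdge e}) (b : Sα.Gc.graph.Branch)
      (v : Sα.Gc.graph.Vertex) (hx : Sα.Gc.graph.edgeOf b = x.1) (hb : Sα.Gc.graph.abuts b = some v),
      ∃ (b' : Sβ.Gc.graph.Branch)
        (hb' : Sβ.Gc.graph.abuts b' = some (F₀.base.vertexMap ⟨v, Set.mem_univ v⟩).1)
        (g : Sβ.Gc.Gv (F₀.base.vertexMap ⟨v, Set.mem_univ v⟩).1),
        Sβ.Gc.graph.edgeOf b' = (σ x).1 ∧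
          (Sα.Gc.branchSubgroup b v hb).map (F₀.hV ⟨v, Set.mem_univ v⟩).toMonoidHom =
            (Sβ.Gc.branchSubgroup b' _ hb').map (MulAut.conj g).toMonoidHom

/-- (C∃) **The isomorphism of graphs of anabelioids induced by `γ` matches the cusps** ([SemiAnbd]
Cor. 3.11, proof, pp. 46–47, observations (i)–(iv): the decomposition groups of the cusps of `Δ[□]^Σ` are
commensurably terminal ((ii) = [AbsAnab] Lem. 1.3.7, FACT-LIST F-0003
`AbsoluteAnabelian.CuspidalData.InertiaCommensurablyTerminal`), are told apart from the edge-like subgroups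
and detected through the node decomposition groups of the coverings `Δ'[□]` corresponding via `γ` ((i),
(iii), (iv) — (iv) geometric: coverings "ramified over the irreducible component … that contains … the
cusp", [Tama2] Thm. 0.2), hence correspond under the isomorphism induced by `γ`), named residual step over
the origin hypotheses (assumed by consumers, asserted for no instance), in the γ-DESCENDED shape: for
`γ : Δ[α] ⥲ Δ[β]`, `φ` descended from `γ` along the admissible quotients and every ISOMORPHISM of graphs of
anabelioids `F₀ : G[α] ⥲ G[β]` compatible with `φ` (the one Cor. 3.9 provides,
`SpecialFibreData.exists_isIso_graphCompatible_of_finite`, unique on underlying semi-graphs), `F₀` matches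
the cusps.  With it the EXISTENCE clause of step (C) (`CuspExtensionUnique`) — and (S3′), Cor. 3.11 — follow
by the combinatorial extension along the matched cusps (proof-only sequels).
[cite: MochizukiSemiAnbd2006, Cor 3.11 pp.46-47] -/
def CuspBranchesPreserved (Ωα : SpecialFibreOrigin Kα) (Ωβ : SpecialFibreOrigin Kβ) : Prop :=
  ∀ (Dα : TemperedArithmeticGroup Kα) (Dβ : TemperedArithmeticGroup Kβ)
    (Sα : SpecialFibreData Dα) (Sβ : SpecialFibreData Dβ),
    Ωα.IsSpecialFibreOf Dα Sα → Ωβ.IsSpecialFibreOf Dβ Sβ →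
    ∀ (γ : Dα.delta ≃ₜ* Dβ.delta) (φ : Sα.chart.G ≃ₜ* Sβ.chart.G),
      (∀ x : Dα.delta, φ (Sα.admissible x) = Sβ.admissible (γ x)) →
      ∀ F₀ : Hom Sα.graph Sβ.graph, F₀.IsIso → Sα.GraphCompatible Sβ φ F₀ → Sα.CuspMatching Sβ F₀

end Cor311

end Literature.AnabelianGeometry.SemiGraphs

end
-- (re-land 2026-08-26T13:49Z: byte-identical declarations; enqueues the stranded olean build of the 12:47Z accept p446232)
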